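import Literature.NumberTheory.Transcendental.KaehlerHodgeHarmonicClosedCounterexample
import Mathlib.Analysis.Calculus.MeanValue
import Mathlib.Analysis.Complex.ReImTopology
import Mathlib.Topology.Instances.Irrational
import HarnessLib

/-!
# The named fact `finrank_dolbeaultHarmonicForms_eq_hodgeNumber` is false as stated
# (the `{id, conj}`-rigged torus, bidegree `(0,0)`)

Theorems-only companion of `Literature/NumberTheory/Transcendental/KaehlerHodge.lean` (C12), written
for the D-0026 review (2026-08-15) of the prove-seat's request to decompose the named fact
`finrank_dolbeaultHarmonicForms_eq_hodgeNumber`. No named fact is introduced.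

`KaehlerHodge.lean` records the numerical form of the Hodge theorem for `∂̄` — C. Voisin, *Hodge
Theory and Complex Algebraic Geometry I* (2002), §5.3.1, Thm. 5.24 (the natural map
`ℋ^{p,q} → H^{p,q}_{∂̄}` is an isomorphism on a compact complex manifold with a Hermitian metric);
D. Huybrechts, *Complex Geometry* (2005), Cor. 3.2.9 — as the named fact
`Literature.NumberTheory.Transcendental.finrank_dolbeaultHarmonicForms_eq_hodgeNumber g o`
("`dim_ℂ ℋ^{p,q} = h^{p,q}` on a compact Hermitian manifold"), a `def … : Prop` written in
`section Hermitian` after `variable … [IsManifold 𝓘(ℂ, E) ω M] [IsManifold 𝓘(ℝ, E) ∞ M] (g …) (o …)`.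

**Finding.** The body of the `def` mentions `g` (hence the real tangent bundle and
`[IsManifold 𝓘(ℝ, E) ∞ M]`) but nothing in it uses the *complex*-manifold instance, so Lean did not
abstract it: `#check @finrank_dolbeaultHarmonicForms_eq_hodgeNumber` lists
`{E} [NormedAddCommGroup E] [NormedSpace ℂ E] {M} [TopologicalSpace M] [ChartedSpace E M] {m : ℕ}
[FiniteDimensional ℂ E] {n : ℕ} [Fact (finrank ℝ E = n)] [IsManifold 𝓘(ℝ, E) ∞ M] (g) (o)` as its
only binders — the defect shared by every fact of sections `Hermitian` and `Kaehler` of that file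
(*Correction* notes in `KaehlerHodge.lean`; `KaehlerHodgeDolbeaultHarmonicCounterexample.lean`,
`KaehlerHodgeComplexAtlasFact.lean`, `KaehlerHodgeHarmonicClosedProofs.lean`,
`KaehlerHodgeConjCounterexample.lean`). The fact is therefore stated for every compact *real* `C^∞`
manifold whose charts take values in `E`, with the "complex structure" multiplication by `i` in the
coordinates of the *preferred chart* `chartAt x` — not a tensor unless the transition maps are
holomorphic — and with `IsOfType`, `∂̄`, `⋆` and `Δ_∂̄` read chart-wise. This file proves that in
that generality the fact is **false** (`TorusConjAtlas.not_finrank_dolbeaultHarmonicForms_eq_hodgeNumber_torus`),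
records the universal closure over exactly the binders the fact elaborates with
(`not_finrank_dolbeaultHarmonicForms_eq_hodgeNumber`; also the surface-level closure
`not_forall_finrank_dolbeaultHarmonicForms_eq_hodgeNumber`), and hence that no closed proof
`finrank_dolbeaultHarmonicForms_eq_hodgeNumber_holds` can exist. At a complex manifold the intended
statement (Voisin, Thm. 5.24; Huybrechts, Cor. 3.2.9) is not an independent result but the numerical
shadow of the Hodge theorem for `∂̄`, the sibling fact `existsUnique_isDolbeaultHarmonic_mk_eq g o`:
the tree proves `finrank_dolbeaultHarmonicForms_eq_hodgeNumber_of_existsUnique`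
(`KaehlerHodgeSymmAssemblyProofs.lean`; the class map `ℋ^{p,q} → H^{p,q}_{∂̄}` is a linear bijection),
which is how the consumers of the predicate `finrank_dolbeaultHarmonicForms_eq_hodgeNumber g o`
(`KaehlerHodgeSymmProofs.lean`, `KaehlerHodgeSerreDualityProofs.lean`) are to be fed — not by a
discharge `finrank_dolbeaultHarmonicForms_eq_hodgeNumber_holds`, which this file rules out. A second,
"corrected" copy of the fact with the holomorphic atlas bound inside is deliberately not vendored: it
would duplicate the debt already carried by `existsUnique_isDolbeaultHarmonic_mk_eq`.

## The counterexample (`namespace TorusConjAtlas`, bidegree `(0,0)`)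

The witness is the rigged torus of `KaehlerHodgeDolbeaultHarmonicCounterexample.lean`:
`M = T² = (ℝ/ℤ)²` charted on `E = ℂ` (`n = 2`) by local inverses of the covering `proj : ℂ → T²`
followed by the frame map `L_q ∈ {id, conj}`, conjugated exactly when the first coordinate of `q`
is a rational point of `ℝ/ℤ` (a dense, co-dense set); the flat metric `metric` (a `C^∞` Riemannian
metric, Hermitian) and the orientation family `orient` (smooth volume form). We take `m = 2`,
`p = q = 0`, so `k = 0` and `Δ_∂̄ = ∂̄*∂̄ = -⋆∂⋆∂̄` on functions.

* **`h^{0,0}(T²) = 1`** (`hodgeNumber_zero_zero`). A smooth complex `0`-form `γ` is a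
  `ℤ²`-periodic `C^∞` function `f = γ ∘ proj` on `ℂ` (`fn`, `contDiff_fn`: the chart
  representative at `q` is `f ∘ L_q`, smooth at the chart centre, and periodicity moves the centre;
  `inChart_eq_fn`, `fn_comp_add_dlt`). The chart-wise condition `∂̄γ = 0` at `q` says that the real
  derivative `D = Df(lift q)` composed with `L_q` is `ℂ`-linear, i.e. `D(i) = ε(q) i D(1)`
  (`fderiv_fn_I_eq`, from `dγ_q = D ∘ L_q`, `mextDeriv_apply_eq_fderiv_fn`, and the decomposition
  `dγ = a dz + b dz̄`, `∂̄γ = b dz̄`, `oneForm_apply_eq`): `D` is **`ℂ`-linear above irrational and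
  conjugate-linear above rational first coordinates**. Both fibres are dense in `ℂ`
  (`dense_irrational`, `Rat.denseRange_cast`, `Complex.isOpenMap_re`), `Df` is continuous, so `Df` is
  both everywhere, hence `Df = 0` and `f` is constant (`is_const_of_fderiv_eq_zero`):
  `γ = f(0) · 1` (`eq_smul_cone_of_dolbeaultBar_eq_zero`). Thus `Z^{0,0}_{∂̄} = ℂ · 1`
  (`dolbeaultClosedForms_zero_zero_eq`; the constant `1` is smooth, of type `(0,0)` and `∂̄`-closed),
  `B^{0,0}_{∂̄} = ⊥` by definition, and `H^{0,0}_{∂̄} ≅ ℂ`.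
* **`dim_ℂ ℋ^{0,0}(T²) ≠ 1`** (`finrank_dolbeaultHarmonicForms_ne_one`). The constant `1` is
  `Δ_∂̄`-harmonic (`isDolbeaultHarmonic_cone`: `d1 = 0` honestly), and so is the non-constant smooth
  function `G ⊗ 1 = F(x)` (`F' = sin³(2π ·)`) — this is the tree's
  `TorusConjAtlas.isDolbeaultHarmonic_g0_ofReal` (`KaehlerHodgeHarmonicClosedCounterexample.lean`:
  on functions `Δ_∂̄ = ∂̄*∂̄`, `∂̄(G ⊗ 1) = \overline{∂(G ⊗ 1)} ≠ 0`, and `∂̄*∂̄(G ⊗ 1) = \overline{⋆∂̄β}`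
  with `β = (iε Sc(x)/2) dz` the form of `KaehlerHodgeDolbeaultHarmonicCounterexample.lean` whose chart
  representatives jump on dense sets, so that its chart-wise `d` is Mathlib's junk `0`). The two
  harmonic functions `1`, `G ⊗ 1` are linearly independent (`F(1/2) - F(0) = 2/(3π)`,
  `linearIndependent_cone_g0`), so `ℋ^{0,0}` contains a plane and `finrank ℂ ℋ^{0,0} ∈ {0} ∪ [2, ∞)`
  (indeed `ℋ^{0,0}` is infinite-dimensional, cf. `KaehlerHodgeFiniteCounterexample.lean` for
  `ℋ^{1,1}`; two independent elements suffice here).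
* Hence `finrank ℂ ℋ^{0,0} ≠ h^{0,0}`, contradicting the fact at `(g, o) = (metric, orient)`,
  `p = q = 0`, `h : (0 + 0) + 2 = 2` (`not_finrank_dolbeaultHarmonicForms_eq_hodgeNumber_torus`).

Every identity used holds at every point; the only junk values are the ones the fact itself feeds
into `∂̄` and `Δ_∂̄` (it quantifies over this real-smooth, non-holomorphic atlas).

## References

* C. Voisin, *Hodge Theory and Complex Algebraic Geometry I*, Cambridge Studies in Advanced
  Mathematics 76 (2002), §5.3.1, Thm. 5.24 — the intended (compact complex manifold) statement.
  [cite: VoisinHodgeI2002, Thm. 5.24]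
* D. Huybrechts, *Complex Geometry. An Introduction*, Universitext (2005), §3.2, Cor. 3.2.9 — the
  same statement ("the canonical projection `ℋ^{p,q}_{∂̄}(X, g) → H^{p,q}(X)` is an isomorphism").
  [cite: Huybrechts2005, Cor. 3.2.9]
-/

noncomputable section

open scoped Manifold ContDiff Topology ComplexConjugate Real
open Bundle Module Set Filter ContinuousAlternatingMap
open Literature.Geometry.Kaehler

namespace Literature.NumberTheory.Transcendental

namespace TorusConjAtlas

section Charts

attribute [local instance] chartedSpaceT isManifoldT bundle Complex.finrank_real_complex_fact

/-! ### The constant function `1` is `∂̄`-closed and `Δ_∂̄`-harmonic -/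

/-- The constant complex `0`-form `1` on the rigged torus. [folklore] -/
def cone : MForm 𝓘(ℝ, ℂ) T ℂ 0 := fun q ↦ constOfIsEmpty ℝ (TangentSpace 𝓘(ℝ, ℂ) q) (Fin 0) (1 : ℂ)

/-- `1(q)() = 1`. [folklore] -/
@[simp] theorem cone_apply (q : T) (v : Fin 0 → TangentSpace 𝓘(ℝ, ℂ) q) : cone q v = 1 := rfl

/-- The chart representatives of `1` are the constant `1` (every chart, every point). [folklore] -/
theorem inChart_cone (x₀ : T) (y : ℂ) : cone.inChart x₀ y = constOfIsEmpty ℝ ℂ (Fin 0) (1 : ℂ) := by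
  ext v
  rw [inChart_apply']
  rfl

/-- `1` is a smooth `0`-form. [folklore] -/
theorem isSmoothForm_cone : IsSmoothForm cone := fun x ↦ by
  rw [funext (inChart_cone x)]
  exact contDiffWithinAt_const

/-- `d1 = 0`. [folklore] -/
theorem mextDeriv_cone : mextDeriv cone = 0 := by
  funext x
  refine mextDeriv_apply_eq_zero ?_
  rw [funext (inChart_cone x), ModelWithCorners.Boundaryless.range_eq_univ, fderivWithin_univ]
  exact fderiv_const_apply _

/-- `∂̄1 = 0`. [folklore] -/
theorem dolbeaultBar_cone : dolbeaultBar cone = 0 := by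
  rw [dolbeaultBar, Finset.Nat.antidiagonal_zero, Finset.sum_singleton,
    (isOfType_zero_zero _).typeComponent_eq_self, mextDeriv_cone, MForm.typeComponent_zero]

/-- `Δ_∂̄ 1 = ∂̄*∂̄1 = 0` (degree `0`, `m + 1 = 2`). [folklore] -/
theorem dolbeaultLaplacian_cone (h : 0 + 0 + 2 = 2) :
    dolbeaultLaplacian orient (0 + 0) 2 h cone = 0 := by
  simp only [dolbeaultLaplacian]
  rw [dolbeaultBar_cone]
  simp [dolbeaultBarAdjoint]

/-- **`1` is `∂̄`-harmonic of type `(0,0)`.** [folklore] -/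
theorem isDolbeaultHarmonic_cone (h : 0 + 0 + 2 = 2) : IsDolbeaultHarmonic orient 0 0 h cone :=
  ⟨isSmoothForm_cone, isOfType_zero_zero _, dolbeaultLaplacian_cone h⟩

/-- `1` is smooth, of type `(0,0)` and `∂̄`-closed: a generator of `Z^{0,0}_{∂̄}`. [folklore] -/
theorem cone_mem_dolbeaultClosedForms : cone ∈ dolbeaultClosedForms ℂ T 0 0 :=
  mem_dolbeaultClosedForms (p := 0) (q := 0) isSmoothForm_cone (isOfType_zero_zero _) dolbeaultBar_cone

/-- `1 ≠ 0`. [folklore] -/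
theorem cone_ne_zero : cone ≠ 0 := by
  intro H
  have := congrArg (fun γ : MForm 𝓘(ℝ, ℂ) T ℂ 0 ↦ γ (proj 0) ![]) H
  simp at this

/-! ### The smooth function `G ⊗ 1 = F(x)` (which is `Δ_∂̄`-harmonic, `isDolbeaultHarmonic_g0_ofReal`) -/

/-- Values of `G ⊗ 1`: `(G ⊗ 1)(q)() = G(q)`. [folklore] -/
theorem g0_ofReal_apply (q : T) (v : Fin 0 → TangentSpace 𝓘(ℝ, ℂ) q) :
    g0.ofReal q v = ((G q : ℝ) : ℂ) := by
  rw [MForm.ofReal_apply]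
  rfl

/-! ### Two independent harmonic functions: `dim_ℂ ℋ^{0,0} ≠ 1` -/

/-- `F(1/2) - F(0) = 2/(3π) ≠ 0` for the primitive `F` of `sin³(2π ·)`. [folklore] -/
theorem F_half_sub_F_zero : TorusRough.F 2⁻¹ - TorusRough.F 0 = 2 / (3 * π) := by
  have hc : Real.cos (2 * π * 2⁻¹) = -1 := by
    rw [show 2 * π * 2⁻¹ = π by ring]
    exact Real.cos_pi
  simp only [TorusRough.F, hc, mul_zero, Real.cos_zero]
  field_simp
  ring

/-- **`1` and `G ⊗ 1` are linearly independent over `ℂ`** (`G = F(x)` is not constant: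
`F(1/2) ≠ F(0)`). [folklore] -/
theorem linearIndependent_cone_g0 : LinearIndependent ℂ ![cone, g0.ofReal] := by
  refine LinearIndependent.pair_iff.2 fun s t hst ↦ ?_
  have h0 := congrArg (fun γ : MForm 𝓘(ℝ, ℂ) T ℂ 0 ↦ γ (proj 0) ![]) hst
  have h1 := congrArg (fun γ : MForm 𝓘(ℝ, ℂ) T ℂ 0 ↦ γ (proj ((2⁻¹ : ℝ) : ℂ)) ![]) hst
  simp only [Pi.add_apply, Pi.smul_apply, ContinuousAlternatingMap.add_apply,
    ContinuousAlternatingMap.smul_apply, cone_apply, g0_ofReal_apply, G_proj, Complex.zero_re,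
    Complex.ofReal_re, smul_eq_mul, mul_one, Pi.zero_apply, ContinuousAlternatingMap.coe_zero] at h0 h1
  have key : t * (((TorusRough.F 2⁻¹ - TorusRough.F 0 : ℝ) : ℂ)) = 0 := by
    push_cast
    linear_combination h1 - h0
  have hne : ((TorusRough.F 2⁻¹ - TorusRough.F 0 : ℝ) : ℂ) ≠ 0 := by
    rw [F_half_sub_F_zero, Complex.ofReal_ne_zero]
    positivity
  have ht : t = 0 := (mul_eq_zero.1 key).resolve_right hne
  rw [ht, zero_mul, add_zero] at h0
  exact ⟨h0, ht⟩

/-- **`dim_ℂ ℋ^{0,0} ≠ 1` on the rigged torus**: `ℋ^{0,0}` contains the two independent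
`∂̄`-harmonic functions `1` and `G ⊗ 1` (so it is either infinite-dimensional, `finrank = 0`, or of
dimension `≥ 2`). [folklore] -/
theorem finrank_dolbeaultHarmonicForms_ne_one (h : 0 + 0 + 2 = 2) :
    finrank ℂ ↥(dolbeaultHarmonicForms orient 0 0 h) ≠ 1 := by
  intro H
  haveI : Module.Finite ℂ ↥(dolbeaultHarmonicForms orient 0 0 h) := Module.finite_of_finrank_eq_succ H
  have hle : Submodule.span ℂ (Set.range ![cone, g0.ofReal]) ≤ dolbeaultHarmonicForms orient 0 0 h := by
    rw [Submodule.span_le]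
    rintro _ ⟨i, rfl⟩
    fin_cases i
    · exact (isDolbeaultHarmonic_cone h).mem_dolbeaultHarmonicForms
    · exact (isDolbeaultHarmonic_g0_ofReal h).mem_dolbeaultHarmonicForms
  have h2 : finrank ℂ ↥(Submodule.span ℂ (Set.range ![cone, g0.ofReal])) = 2 := by
    rw [finrank_span_eq_card linearIndependent_cone_g0, Fintype.card_fin]
  have h3 : finrank ℂ ↥(Submodule.span ℂ (Set.range ![cone, g0.ofReal])) ≤
      finrank ℂ ↥(dolbeaultHarmonicForms orient 0 0 h) := Submodule.finrank_mono hle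
  rw [h2, H] at h3
  exact absurd h3 (by norm_num)

/-! ### `Z^{0,0}_{∂̄}` of the rigged torus is the line of constants, so `h^{0,0} = 1` -/

/-- The `ℤ²`-periodic function on `ℂ` underlying a `0`-form `γ` on `T²`: `f(w) = γ(proj w)`. [folklore] -/
def fn (γ : MForm 𝓘(ℝ, ℂ) T ℂ 0) (w : ℂ) : ℂ := γ (proj w) ![]

/-- A `0`-form is the value of its periodic function at any lift: `γ(q) = f(lift q)`. [folklore] -/
theorem apply_eq_fn (γ : MForm 𝓘(ℝ, ℂ) T ℂ 0) (q : T) (v : Fin 0 → TangentSpace 𝓘(ℝ, ℂ) q) :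
    γ q v = fn γ (lift q) := by
  rw [fn, proj_lift, Subsingleton.elim v ![]]

/-- The chart representatives of a `0`-form: `γ.inChart x₀ y = f(L_{x₀} y)`. [folklore] -/
theorem inChart_eq_fn (γ : MForm 𝓘(ℝ, ℂ) T ℂ 0) (x₀ : T) (y : ℂ) :
    γ.inChart x₀ y = constOfIsEmpty ℝ ℂ (Fin 0) (fn γ (L x₀ y)) := by
  ext v
  rw [inChart_apply', constOfIsEmpty_apply, fn]
  congr 1
  exact Subsingleton.elim _ _

/-- `proj (w + d) = proj w` when `proj d = 0` (`proj` is additive). [folklore] -/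
theorem proj_add_eq (w d : ℂ) (hd : proj d = 0) : proj (w + d) = proj w := by
  have := proj_sub (w + d) d
  rw [add_sub_cancel_right, hd, sub_zero] at this
  exact this.symm

/-- The lattice vector `lift (proj w) - w`. [folklore] -/
def dlt (w : ℂ) : ℂ := lift (proj w) - w

/-- `proj (lift (proj w) - w) = 0`. [folklore] -/
theorem proj_dlt (w : ℂ) : proj (dlt w) = 0 := by
  rw [dlt, proj_sub, proj_lift, sub_self]

/-- `w + (lift (proj w) - w) = lift (proj w)`. [folklore] -/
theorem add_dlt (w : ℂ) : w + dlt w = lift (proj w) := by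
  rw [dlt, add_sub_cancel]

/-- **Periodicity**: `f(· + d) = f` for the lattice vector `d = lift (proj w) - w`. [folklore] -/
theorem fn_comp_add_dlt (γ : MForm 𝓘(ℝ, ℂ) T ℂ 0) (w : ℂ) : (fun w' ↦ fn γ (w' + dlt w)) = fn γ := by
  funext w'
  simp only [fn]
  rw [proj_add_eq _ _ (proj_dlt w)]

variable {γ : MForm 𝓘(ℝ, ℂ) T ℂ 0}

/-- For a smooth `0`-form, `f` is `C^∞` at every lift `lift q` (the chart representative at `q`
is `f ∘ L_q`, smooth at the chart centre, and `L_q` is an involution). [folklore] -/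
theorem contDiffAt_fn_lift (hγ : IsSmoothForm γ) (q : T) : ContDiffAt ℝ ∞ (fn γ) (lift q) := by
  have h1 : ContDiffAt ℝ ∞ (γ.inChart q) (extChartAt 𝓘(ℝ, ℂ) q q) := by
    have := hγ q
    rwa [ModelWithCorners.Boundaryless.range_eq_univ, contDiffWithinAt_univ] at this
  rw [funext (inChart_eq_fn γ q)] at h1
  have h2 : ContDiffAt ℝ ∞ (fun y ↦ fn γ (L q y)) (extChartAt 𝓘(ℝ, ℂ) q q) := by
    have := (ContinuousAlternatingMap.apply ℝ ℂ ℂ (![] : Fin 0 → ℂ)).contDiff.contDiffAt.comp _ h1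
    simpa [Function.comp_def] using this
  have h3 : fn γ = (fun y ↦ fn γ (L q y)) ∘ (L q) := by
    funext w
    simp only [Function.comp_apply, L_L]
  have hpt : L q (lift q) = extChartAt 𝓘(ℝ, ℂ) q q := by rw [lift, L_L]
  rw [h3]
  refine ContDiffAt.comp _ ?_ (L q).contDiff.contDiffAt
  rw [hpt]
  exact h2

/-- **`f` is `C^∞` on `ℂ`** for a smooth `0`-form `γ` (smooth at the lifts, and periodic). [folklore] -/
theorem contDiff_fn (hγ : IsSmoothForm γ) : ContDiff ℝ ∞ (fn γ) := by
  rw [contDiff_iff_contDiffAt]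
  intro w
  have h := contDiffAt_fn_lift hγ (proj w)
  rw [← add_dlt w] at h
  have h2 : ContDiffAt ℝ ∞ (fun w' ↦ fn γ (w' + dlt w)) w :=
    h.comp w (contDiffAt_id.add contDiffAt_const)
  rwa [fn_comp_add_dlt] at h2

/-- **`dγ` in terms of `f`**: `dγ_q(v) = Df(lift q)(L_q v)` for a smooth `0`-form. [folklore] -/
theorem mextDeriv_apply_eq_fderiv_fn (hγ : IsSmoothForm γ) (q : T)
    (v : Fin 1 → TangentSpace 𝓘(ℝ, ℂ) q) :
    mextDeriv γ q v = fderiv ℝ (fn γ) (lift q) (L q (v 0)) := by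
  rw [mextDeriv_eq_extDerivWithin, funext (inChart_eq_fn γ q),
    ModelWithCorners.Boundaryless.range_eq_univ, extDerivWithin_univ, extDeriv_constOfIsEmpty]
  change fderiv ℝ (fun x ↦ fn γ (L q x)) (extChartAt 𝓘(ℝ, ℂ) q q) (v 0) = _
  have hd : DifferentiableAt ℝ (fn γ) (L q (extChartAt 𝓘(ℝ, ℂ) q q)) :=
    ((contDiff_fn hγ).differentiable (by simp)).differentiableAt
  have hcomp : (fun y ↦ fn γ (L q y)) = fn γ ∘ (L q) := rfl
  rw [hcomp, fderiv_comp _ hd (L q).differentiableAt, (L q).fderiv, ContinuousLinearMap.comp_apply]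
  rfl

/-- A real-linear `1`-form on `ℂ` decomposed along `dz`, `dz̄`:
`A(w) = ½(A(1) - iA(i)) w + ½(A(1) + iA(i)) w̄`. [folklore] -/
theorem oneForm_apply_eq {q : T} (A : TangentSpace 𝓘(ℝ, ℂ) q [⋀^Fin 1]→L[ℝ] ℂ) (w : ℂ) :
    A ![w] = (A ![(1 : ℂ)] - Complex.I * A ![Complex.I]) / 2 * w +
      (A ![(1 : ℂ)] + Complex.I * A ![Complex.I]) / 2 * (starRingEnd ℂ) w := by
  suffices h : ∀ x y : ℝ, A ![((x : ℂ) + (y : ℂ) * Complex.I : ℂ)] =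
      (A ![(1 : ℂ)] - Complex.I * A ![Complex.I]) / 2 * ((x : ℂ) + (y : ℂ) * Complex.I) +
        (A ![(1 : ℂ)] + Complex.I * A ![Complex.I]) / 2 *
          (starRingEnd ℂ) ((x : ℂ) + (y : ℂ) * Complex.I) by
    have := h w.re w.im
    rwa [Complex.re_add_im] at this
  intro x y
  set φ : ℂ →L[ℝ] ℂ := (ofSubsingleton ℝ (TangentSpace 𝓘(ℝ, ℂ) q) ℂ (0 : Fin 1)).symm A with hφ
  have hA : A = ofSubsingleton ℝ (TangentSpace 𝓘(ℝ, ℂ) q) ℂ (0 : Fin 1) φ := by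
    rw [hφ, Equiv.apply_symm_apply]
  have key : ∀ u : ℂ, A ![u] = φ u := fun u ↦ by
    rw [hA]
    rfl
  rw [key, key, key]
  have e1 : ((x : ℂ) : ℂ) = (x : ℝ) • (1 : ℂ) := by rw [Complex.real_smul, mul_one]
  have e2 : (y : ℂ) * Complex.I = (y : ℝ) • Complex.I := by rw [Complex.real_smul]
  have hlin : φ ((x : ℂ) + (y : ℂ) * Complex.I) = (x : ℂ) * φ 1 + (y : ℂ) * φ Complex.I :=
    calc φ ((x : ℂ) + (y : ℂ) * Complex.I) = φ ((x : ℝ) • (1 : ℂ) + (y : ℝ) • Complex.I) := by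
          rw [← e1, ← e2]
      _ = (x : ℝ) • φ 1 + (y : ℝ) • φ Complex.I := by rw [map_add, φ.map_smul, φ.map_smul]
      _ = (x : ℂ) * φ 1 + (y : ℂ) * φ Complex.I := by rw [Complex.real_smul, Complex.real_smul]
  have hconj : (starRingEnd ℂ) ((x : ℂ) + (y : ℂ) * Complex.I) = (x : ℂ) - (y : ℂ) * Complex.I := by
    rw [map_add, map_mul, Complex.conj_ofReal, Complex.conj_ofReal, Complex.conj_I]
    ring
  rw [hlin, hconj]
  linear_combination ((y : ℂ) * φ Complex.I) * Complex.I_mul_I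

/-- **`∂̄γ = 0` read on the derivative of `f`**: for a smooth `0`-form `γ` with `∂̄γ = 0`, at
every `q` the real derivative `D = Df(lift q)` satisfies `D(i) = ε(q) · i · D(1)` — it is
`ℂ`-linear at unrigged points and conjugate-linear at rigged ones (the `(0,1)`-part of
`dγ_q = D ∘ L_q` vanishes). [folklore] -/
theorem fderiv_fn_I_eq (hγ : IsSmoothForm γ) (hd : dolbeaultBar γ = 0) (q : T) :
    fderiv ℝ (fn γ) (lift q) Complex.I =
      ((sgn q : ℝ) : ℂ) * Complex.I * fderiv ℝ (fn γ) (lift q) 1 := by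
  -- decompose `dγ = a dz + b dz̄` pointwise
  set a : T → ℂ := fun x ↦
    (mextDeriv γ x ![(1 : ℂ)] - Complex.I * mextDeriv γ x ![Complex.I]) / 2 with ha
  set b : T → ℂ := fun x ↦
    (mextDeriv γ x ![(1 : ℂ)] + Complex.I * mextDeriv γ x ![Complex.I]) / 2 with hb
  have hdec : mextDeriv γ = (fun x ↦ a x • dz x) + fun x ↦ b x • dzbar x := by
    funext x; ext v
    obtain ⟨w, rfl⟩ : ∃ w, v = ![w] := ⟨v 0, by funext i; fin_cases i; rfl⟩
    rw [oneForm_apply_eq]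
    simp only [ha, hb, Pi.add_apply, ContinuousAlternatingMap.add_apply,
      ContinuousAlternatingMap.smul_apply, smul_eq_mul, dz_apply, dzbar_apply, Matrix.cons_val_zero]
  -- `∂̄γ = b dz̄`, so `b q = 0`
  have hbar : dolbeaultBar γ = fun x ↦ b x • dzbar x := by
    rw [dolbeaultBar, Finset.Nat.antidiagonal_zero, Finset.sum_singleton,
      (isOfType_zero_zero _).typeComponent_eq_self, hdec, MForm.typeComponent_add,
      IsOfType.typeComponent_of_ne_holds (isOfType_smul_dz _) (Or.inl (by norm_num)),
      (isOfType_smul_dzbar _).typeComponent_eq_self]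
    exact zero_add _
  have hbq : b q = 0 := by
    have := congrArg (fun δ : MForm 𝓘(ℝ, ℂ) T ℂ 1 ↦ δ q ![(1 : ℂ)]) hd
    simpa [hbar] using this
  have hb0 : mextDeriv γ q ![(1 : ℂ)] + Complex.I * mextDeriv γ q ![Complex.I] = 0 := by
    have := hbq
    simp only [hb] at this
    linear_combination 2 * this
  -- read `dγ_q` through `f`
  have h1 : mextDeriv γ q ![(1 : ℂ)] = fderiv ℝ (fn γ) (lift q) 1 := by
    rw [mextDeriv_apply_eq_fderiv_fn hγ, Matrix.cons_val_zero]
    congr 1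
    apply Complex.ext
    · rw [re_L, Complex.one_re]
    · rw [im_L, Complex.one_im, mul_zero]
  have hI : mextDeriv γ q ![Complex.I] = ((sgn q : ℝ) : ℂ) * fderiv ℝ (fn γ) (lift q) Complex.I := by
    rw [mextDeriv_apply_eq_fderiv_fn hγ, Matrix.cons_val_zero]
    have hL : L q Complex.I = (sgn q : ℝ) • Complex.I := by
      apply Complex.ext
      · rw [re_L, Complex.I_re, Complex.real_smul, Complex.mul_re, Complex.ofReal_re,
          Complex.ofReal_im, Complex.I_re, Complex.I_im, mul_zero, zero_mul, sub_zero]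
      · rw [im_L, Complex.I_im, mul_one, Complex.real_smul, Complex.mul_im, Complex.ofReal_re,
          Complex.ofReal_im, Complex.I_re, Complex.I_im, mul_one, zero_mul, add_zero]
    rw [hL, ContinuousLinearMap.map_smul, Complex.real_smul]
  rw [h1, hI] at hb0
  have hs : ((sgn q : ℝ) : ℂ) * ((sgn q : ℝ) : ℂ) = 1 := by
    rw [← Complex.ofReal_mul, sgn_mul_sgn, Complex.ofReal_one]
  linear_combination (-(((sgn q : ℝ) : ℂ) * Complex.I)) * hb0 +
    (fderiv ℝ (fn γ) (lift q) Complex.I * Complex.I * Complex.I) * hs +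
    (fderiv ℝ (fn γ) (lift q) Complex.I) * Complex.I_mul_I

/-- The derivative of the periodic `f` is periodic: `Df(w) = Df(lift (proj w))`. [folklore] -/
theorem fderiv_fn_eq_fderiv_lift (γ : MForm 𝓘(ℝ, ℂ) T ℂ 0) (w : ℂ) :
    fderiv ℝ (fn γ) w = fderiv ℝ (fn γ) (lift (proj w)) := by
  rw [← add_dlt w, ← fderiv_comp_add_right (dlt w), fn_comp_add_dlt]

/-- `{w : ℂ | Re w ∈ s}` is dense when `s ⊆ ℝ` is (`Re` is an open map). [folklore] -/
theorem dense_re_mem {s : Set ℝ} (hs : Dense s) : Dense {w : ℂ | w.re ∈ s} :=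
  hs.preimage Complex.isOpenMap_re

/-- **A `∂̄`-closed smooth function on the rigged torus is constant.** For a smooth `0`-form `γ`
with `∂̄γ = 0` (chart-wise), `Df(w)` is `ℂ`-linear when `Re w` is irrational and conjugate-linear
when `Re w` is rational (`fderiv_fn_I_eq` and periodicity); `Df` is continuous and both sets are
dense, so `Df(w)` is both, i.e. `Df = 0`, and `f` is constant: `γ = f(0) · 1`. [folklore] -/
theorem eq_smul_cone_of_dolbeaultBar_eq_zero (hγ : IsSmoothForm γ) (hd : dolbeaultBar γ = 0) :
    γ = fn γ 0 • cone := by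
  set g : ℂ → ℂ →L[ℝ] ℂ := fun w ↦ fderiv ℝ (fn γ) w with hg
  have hgc : Continuous g := (contDiff_fn hγ).continuous_fderiv (by simp)
  -- the relation at every point, with the sign `ρ(Re w)`
  have hrel : ∀ w : ℂ, g w Complex.I = ((ρ w.re : ℝ) : ℂ) * Complex.I * g w 1 := by
    intro w
    simp only [hg]
    rw [fderiv_fn_eq_fderiv_lift γ w, ← sgn_proj]
    exact fderiv_fn_I_eq hγ hd (proj w)
  have hc1 : Continuous fun w ↦ g w Complex.I :=
    (ContinuousLinearMap.apply ℝ ℂ Complex.I).continuous.comp hgc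
  have hc2 : Continuous fun w ↦ g w 1 := (ContinuousLinearMap.apply ℝ ℂ (1 : ℂ)).continuous.comp hgc
  -- `ℂ`-linear on the closure of the irrational fibres, i.e. everywhere
  have hplus : ∀ w : ℂ, g w Complex.I = Complex.I * g w 1 := by
    have hcl : IsClosed {w : ℂ | g w Complex.I = Complex.I * g w 1} :=
      isClosed_eq hc1 (continuous_const.mul hc2)
    have hD : Dense {w : ℂ | g w Complex.I = Complex.I * g w 1} := by
      refine (dense_re_mem dense_irrational).mono fun w (hw : Irrational w.re) ↦ ?_
      show g w Complex.I = Complex.I * g w 1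
      rw [hrel w, ρ, if_pos hw, Complex.ofReal_one, one_mul]
    have huniv : {w : ℂ | g w Complex.I = Complex.I * g w 1} = univ := by
      rw [← hcl.closure_eq, hD.closure_eq]
    intro w
    have : w ∈ {w : ℂ | g w Complex.I = Complex.I * g w 1} := by rw [huniv]; trivial
    exact this
  -- conjugate-linear on the closure of the rational fibres, i.e. everywhere
  have hminus : ∀ w : ℂ, g w Complex.I = -(Complex.I * g w 1) := by
    have hcl : IsClosed {w : ℂ | g w Complex.I = -(Complex.I * g w 1)} :=
      isClosed_eq hc1 (continuous_const.mul hc2).neg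
    have hQ : Dense {t : ℝ | ¬ Irrational t} := by
      refine Rat.denseRange_cast.mono ?_
      rintro t ⟨r, rfl⟩
      exact Rat.not_irrational r
    have hD : Dense {w : ℂ | g w Complex.I = -(Complex.I * g w 1)} := by
      refine (dense_re_mem hQ).mono fun w (hw : ¬ Irrational w.re) ↦ ?_
      show g w Complex.I = -(Complex.I * g w 1)
      rw [hrel w, ρ, if_neg hw]
      push_cast
      ring
    have huniv : {w : ℂ | g w Complex.I = -(Complex.I * g w 1)} = univ := by
      rw [← hcl.closure_eq, hD.closure_eq]
    intro w
    have : w ∈ {w : ℂ | g w Complex.I = -(Complex.I * g w 1)} := by rw [huniv]; trivial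
    exact this
  -- hence `Df = 0`
  have hzero : ∀ w : ℂ, fderiv ℝ (fn γ) w = 0 := by
    intro w
    have h1 : g w 1 = 0 := by
      have := (hplus w).symm.trans (hminus w)
      -- `I * g w 1 = -(I * g w 1)`
      have h2 : Complex.I * g w 1 = 0 := by linear_combination this / 2
      simpa [Complex.I_ne_zero] using h2
    have hI : g w Complex.I = 0 := by rw [hplus w, h1, mul_zero]
    ext u
    change g w u = 0
    have e1 : (u.re : ℂ) = (u.re : ℝ) • (1 : ℂ) := by rw [Complex.real_smul, mul_one]
    have e2 : (u.im : ℂ) * Complex.I = (u.im : ℝ) • Complex.I := by rw [Complex.real_smul]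
    rw [← Complex.re_add_im u, map_add, e1, e2, (g w).map_smul, (g w).map_smul, h1, hI, smul_zero,
      smul_zero, add_zero]
  have hconst : ∀ w w' : ℂ, fn γ w = fn γ w' :=
    is_const_of_fderiv_eq_zero ((contDiff_fn hγ).differentiable (by simp)) hzero
  funext q; ext v
  rw [apply_eq_fn, Pi.smul_apply, ContinuousAlternatingMap.smul_apply, cone_apply, smul_eq_mul, mul_one]
  exact hconst _ _

/-- **`Z^{0,0}_{∂̄}(T²) = ℂ · 1`** for the rigged torus: the `∂̄`-closed smooth functions are the
constants. [folklore] -/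
theorem dolbeaultClosedForms_zero_zero_eq : dolbeaultClosedForms ℂ T 0 0 = ℂ ∙ cone := by
  apply le_antisymm
  · rw [dolbeaultClosedForms, Submodule.span_le]
    rintro γ ⟨hs, -, hd⟩
    rw [SetLike.mem_coe, Submodule.mem_span_singleton]
    exact ⟨fn γ 0, (eq_smul_cone_of_dolbeaultBar_eq_zero hs hd).symm⟩
  · rw [Submodule.span_singleton_le_iff_mem]
    exact cone_mem_dolbeaultClosedForms

/-- **`h^{0,0}(T²) = 1`** for the rigged torus (`H^{0,0}_{∂̄} = Z^{0,0}_{∂̄} / 0 = ℂ · 1`). [folklore] -/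
theorem hodgeNumber_zero_zero : hodgeNumber ℂ T 0 0 = 1 := by
  have e := Submodule.quotEquivOfEqBot
    ((dolbeaultExactForms ℂ T 0 0).comap (dolbeaultClosedForms ℂ T 0 0).subtype)
    (by rw [dolbeaultExactForms_zero, Submodule.comap_bot, Submodule.ker_subtype])
  unfold hodgeNumber dolbeaultCohomology
  rw [e.finrank_eq, dolbeaultClosedForms_zero_zero_eq]
  exact finrank_span_singleton cone_ne_zero

/-! ### Assembly -/

/-- **The named fact `finrank_dolbeaultHarmonicForms_eq_hodgeNumber` is false for the rigged torus**
(`E = ℂ`, `n = 2`, `m = 2`, bidegree `(0,0)`, the flat `C^∞` metric `metric`, which is Hermitian,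
and the orientation family `orient`, whose volume form is smooth): `dim_ℂ ℋ^{0,0} ≠ 1 = h^{0,0}`.
[folklore] -/
theorem not_finrank_dolbeaultHarmonicForms_eq_hodgeNumber_torus :
    ¬ finrank_dolbeaultHarmonicForms_eq_hodgeNumber (m := 2) metric orient := by
  intro H
  have h2 : (0 + 0 + 2 : ℕ) = 2 := rfl
  have key := H isHermitian (p := 0) (q := 0) h2 isSmoothForm_riemannianVolumeForm
  rw [hodgeNumber_zero_zero] at key
  exact finrank_dolbeaultHarmonicForms_ne_one h2 key

end Charts

end TorusConjAtlas

section UniversalClosure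

attribute [local instance] TorusConjAtlas.chartedSpaceT TorusConjAtlas.isManifoldT
  Complex.finrank_real_complex_fact

/-- **`finrank_dolbeaultHarmonicForms_eq_hodgeNumber` fails already over compact real `C^∞` surfaces
charted in `ℂ`** (smooth metric, any orientation family), with `m = 2` (bidegree `(0,0)`): witness
the rigged torus `TorusConjAtlas.T` with the flat metric
(`TorusConjAtlas.not_finrank_dolbeaultHarmonicForms_eq_hodgeNumber_torus`). [folklore] -/
theorem not_forall_finrank_dolbeaultHarmonicForms_eq_hodgeNumber :
    ¬ ∀ (M : Type) [TopologicalSpace M] [ChartedSpace ℂ M] [IsManifold 𝓘(ℝ, ℂ) ∞ M]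
        (g : ContMDiffRiemannianMetric 𝓘(ℝ, ℂ) ∞ ℂ (fun x : M ↦ TangentSpace 𝓘(ℝ, ℂ) x))
        (o : (x : M) → Orientation ℝ (TangentSpace 𝓘(ℝ, ℂ) x) (Fin 2)),
        finrank_dolbeaultHarmonicForms_eq_hodgeNumber (m := 2) g o :=
  fun H ↦ TorusConjAtlas.not_finrank_dolbeaultHarmonicForms_eq_hodgeNumber_torus
    (H TorusConjAtlas.T TorusConjAtlas.metric TorusConjAtlas.orient)

/-- **The named fact `finrank_dolbeaultHarmonicForms_eq_hodgeNumber` is false as stated.** Closed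
universally over exactly the binders it elaborates with — a finite-dimensional complex normed space
`E` with `finrank ℝ E = n`, a charted space `M` over `E` that is a *real* `C^∞` manifold (no
`[IsManifold 𝓘(ℂ, E) ω M]`), the codegree `m`, a `C^∞` Riemannian metric `g` and an orientation
family `o` — the statement fails: witness `E = ℂ`, `n = 2`, `m = 2`, the compact Hausdorff torus
`(ℝ/ℤ)²` with the `{id, conj}`-rigged real-analytic atlas `TorusConjAtlas.chartedSpaceT`, the flat
(Hermitian) metric and the orientation `TorusConjAtlas.orient`, in bidegree `(0,0)`. Hence no closed
proof `finrank_dolbeaultHarmonicForms_eq_hodgeNumber_holds` can exist. [folklore] -/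
theorem not_finrank_dolbeaultHarmonicForms_eq_hodgeNumber :
    ¬ ∀ {E : Type} [NormedAddCommGroup E] [NormedSpace ℂ E] {M : Type} [TopologicalSpace M]
        [ChartedSpace E M] {m : ℕ} [FiniteDimensional ℂ E] {n : ℕ} [Fact (finrank ℝ E = n)]
        [IsManifold 𝓘(ℝ, E) ∞ M]
        (g : ContMDiffRiemannianMetric 𝓘(ℝ, E) ∞ E (fun x : M ↦ TangentSpace 𝓘(ℝ, E) x))
        (o : (x : M) → Orientation ℝ (TangentSpace 𝓘(ℝ, E) x) (Fin n)),
        finrank_dolbeaultHarmonicForms_eq_hodgeNumber (m := m) g o :=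
  fun H ↦ not_forall_finrank_dolbeaultHarmonicForms_eq_hodgeNumber fun M _ _ _ g o ↦
    @H ℂ _ _ M _ _ 2 _ 2 Complex.finrank_real_complex_fact _ g o

end UniversalClosure

end Literature.NumberTheory.Transcendental
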